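import Summits.HubbardSuperconductivity.HubbardSuperconductivity.Theorems.AnisotropyChordTransferFibre3C0Perm

/-!
# Route `AnisotropyChord` / H0 rotor rung: PartN41-C §4 — `ShellReduction` PROVED: `Sh ≤ 12·Σ_{b ∉ {0,x̂}} C0(x̂,b)²`

Theory-1 g22's PartN41-C §4 `ShellReduction` (port …Fibre3KT2bRow): the contact-shell sum `Sh = Σ_{W ≥ 1} C0²` is bounded by
the union bound `1_{W ≥ 1} ≤ W = 1_{a ∈ NN} + 1_{b ∈ NN} + 1_{b−a ∈ NN}` (★ `nC0shell_le_Wsum`), the three classes are equal by the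
`S₃` relabelling symmetries of `C0` (`C0fn_swap`, `C0fn_rot`; ★ `sum_snd_eq_fst`, `sum_diff_eq_fst`), and within the class
`a ∈ NN` the four sub-sums `Σ_b C0(e,b)²`, `e ∈ NN`, are equal by inversion and the coordinate swap (`C0fn_neg`, `C0fn_sw`;
★ `rowSum_nn`), whence ★ `shell_reduction : Sh ≤ 12·Σ_{b ∉ {0,x̂}} C0(x̂,b)²` for every even, swap-symmetric profile (no `L ≥ 3`
needed: the count of nearest-neighbour vectors is bounded by `4` without distinctness) and ★ `shellReduction_holds (Δ) : ShellReduction L Δ`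
(the x-mirror hypothesis of the typed target is not used).
Prover seat `hubbard-h0-rotor-p1` g27 (route lead); helper for stmt-HubbardSuperconductivity-23918 (`--supports`, helper class).
WHAT THIS IS NOT: nothing here proves superconductivity in the Hubbard model; one inequality of ONE row of ONE conditional
reduction.  Tree imports only; no new definitions; no sorry, no axioms.
-/

set_option linter.dupNamespace false
set_option autoImplicit false

noncomputable section

open scoped BigOperators

namespace Summit.HubbardSuperconductivity.HubbardSuperconductivity.Theorems.AnisotropyChord.Transfer.Fibre3

variable (L : ℕ) [NeZero L]

namespace ShellRow

/-! ## §1 The union bound `1_{W ≥ 1} ≤ W` -/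

/-- `Sh ≤ Σ_c W(c)·C0(c)²`. [folklore] -/
theorem nC0shell_le_Wsum (Δ lam2 : ℝ) (f : Tor L → ℝ) :
    nC0shell L Δ lam2 f ≤ ∑ c : Cfg L, (Wcount L c : ℝ) * C0fn L Δ lam2 f c ^ 2 := by
  classical
  unfold nC0shell
  rw [Finset.sum_filter]
  refine Finset.sum_le_sum fun c _ => ?_
  have h2 : 0 ≤ C0fn L Δ lam2 f c ^ 2 := sq_nonneg _
  split_ifs with h
  · have h1 : (1 : ℝ) ≤ (Wcount L c : ℝ) := by exact_mod_cast Nat.one_le_iff_ne_zero.mpr h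
    nlinarith
  · positivity

/-- `Σ_c W·C0² = Σ_c [a ∈ NN]C0² + Σ_c [b ∈ NN]C0² + Σ_c [b − a ∈ NN]C0²`. [folklore] -/
theorem Wsum_eq (Δ lam2 : ℝ) (f : Tor L → ℝ) :
    ∑ c : Cfg L, (Wcount L c : ℝ) * C0fn L Δ lam2 f c ^ 2
      = (∑ c : Cfg L, (if IsNN L c.1 = true then (1 : ℝ) else 0) * C0fn L Δ lam2 f c ^ 2)
        + (∑ c : Cfg L, (if IsNN L c.2 = true then (1 : ℝ) else 0) * C0fn L Δ lam2 f c ^ 2)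
        + (∑ c : Cfg L, (if IsNN L (c.2 - c.1) = true then (1 : ℝ) else 0) * C0fn L Δ lam2 f c ^ 2) := by
  rw [← Finset.sum_add_distrib, ← Finset.sum_add_distrib]
  refine Finset.sum_congr rfl fun c _ => ?_
  unfold Wcount
  push_cast
  ring

/-! ## §2 The three classes are equal (`S₃`) -/

/-- `Σ_c [b ∈ NN]C0(c)² = Σ_c [a ∈ NN]C0(c)²` (relabelling `2 ↔ 3`). [folklore] -/
theorem sum_snd_eq_fst (Δ lam2 : ℝ) {f : Tor L → ℝ} (heven : ∀ r : Tor L, f (-r) = f r) :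
    ∑ c : Cfg L, (if IsNN L c.2 = true then (1 : ℝ) else 0) * C0fn L Δ lam2 f c ^ 2
      = ∑ c : Cfg L, (if IsNN L c.1 = true then (1 : ℝ) else 0) * C0fn L Δ lam2 f c ^ 2 := by
  refine Fintype.sum_equiv (Equiv.prodComm (Tor L) (Tor L)) _ _ (fun c => ?_)
  rw [Equiv.prodComm_apply, Prod.swap, C0fn_swap L Δ lam2 heven c]

/-- `Σ_c [b − a ∈ NN]C0(c)² = Σ_c [a ∈ NN]C0(c)²` (relabelling `(a,b) ↦ (b − a, −a)`). [folklore] -/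
theorem sum_diff_eq_fst (Δ lam2 : ℝ) {f : Tor L → ℝ} (heven : ∀ r : Tor L, f (-r) = f r) :
    ∑ c : Cfg L, (if IsNN L (c.2 - c.1) = true then (1 : ℝ) else 0) * C0fn L Δ lam2 f c ^ 2
      = ∑ c : Cfg L, (if IsNN L c.1 = true then (1 : ℝ) else 0) * C0fn L Δ lam2 f c ^ 2 := by
  let ψ : Cfg L ≃ Cfg L :=
    { toFun := fun c => (c.2 - c.1, -c.1)
      invFun := fun c => (-c.2, c.1 - c.2)
      left_inv := fun c => Prod.ext (by simp) (by simp)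
      right_inv := fun c => Prod.ext (by simp) (by simp) }
  refine Fintype.sum_equiv ψ _ _ (fun c => ?_)
  show _ = (if IsNN L (c.2 - c.1) = true then (1 : ℝ) else 0) * C0fn L Δ lam2 f (c.2 - c.1, -c.1) ^ 2
  rw [C0fn_rot L Δ lam2 heven c]

/-- the class `a ∈ NN` as a sum of rows: `Σ_c [a ∈ NN]C0(c)² = Σ_a [a ∈ NN]·Σ_b C0(a,b)²`. [folklore] -/
theorem sum_fst_rows (Δ lam2 : ℝ) (f : Tor L → ℝ) :
    ∑ c : Cfg L, (if IsNN L c.1 = true then (1 : ℝ) else 0) * C0fn L Δ lam2 f c ^ 2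
      = ∑ a : Tor L, (if IsNN L a = true then (1 : ℝ) else 0) * ∑ b : Tor L, C0fn L Δ lam2 f (a, b) ^ 2 := by
  rw [Fintype.sum_prod_type]
  refine Finset.sum_congr rfl fun a _ => ?_
  rw [Finset.mul_sum]

/-! ## §3 The four rows `e ∈ NN` are equal (inversion and the coordinate swap) -/

/-- `Σ_b C0(−a, b)² = Σ_b C0(a, b)²` (inversion, even `f`). [folklore] -/
theorem rowSum_neg (Δ lam2 : ℝ) {f : Tor L → ℝ} (heven : ∀ r : Tor L, f (-r) = f r) (a : Tor L) :
    ∑ b : Tor L, C0fn L Δ lam2 f (-a, b) ^ 2 = ∑ b : Tor L, C0fn L Δ lam2 f (a, b) ^ 2 := by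
  symm
  refine Fintype.sum_equiv (Equiv.neg (Tor L)) _ _ (fun b => ?_)
  rw [Equiv.neg_apply, ← C0fn_neg L Δ lam2 heven (a, b), Prod.neg_mk]

/-- `Σ_b C0((a₂,a₁), b)² = Σ_b C0(a, b)²` (coordinate swap, swap-symmetric `f`). [folklore] -/
theorem rowSum_sw (Δ lam2 : ℝ) {f : Tor L → ℝ} (hsw : ∀ r : Tor L, f (r.2, r.1) = f r) (a : Tor L) :
    ∑ b : Tor L, C0fn L Δ lam2 f ((a.2, a.1), b) ^ 2 = ∑ b : Tor L, C0fn L Δ lam2 f (a, b) ^ 2 := by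
  symm
  refine Fintype.sum_equiv (Equiv.prodComm (ZMod L) (ZMod L)) _ _ (fun b => ?_)
  rw [Equiv.prodComm_apply, Prod.swap, ← C0fn_sw L Δ lam2 hsw a b]

/-- ★ every nearest-neighbour row equals the `x̂` row (even, swap-symmetric `f`). [folklore] -/
theorem rowSum_nn (Δ lam2 : ℝ) {f : Tor L → ℝ} (heven : ∀ r : Tor L, f (-r) = f r)
    (hsw : ∀ r : Tor L, f (r.2, r.1) = f r) {a : Tor L} (ha : IsNN L a = true) :
    ∑ b : Tor L, C0fn L Δ lam2 f (a, b) ^ 2 = ∑ b : Tor L, C0fn L Δ lam2 f (ex L, b) ^ 2 := by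
  have hy : ∑ b : Tor L, C0fn L Δ lam2 f (ey L, b) ^ 2 = ∑ b : Tor L, C0fn L Δ lam2 f (ex L, b) ^ 2 := by
    have e : ey L = (((ex L).2, (ex L).1) : Tor L) := rfl
    rw [e, rowSum_sw L Δ lam2 hsw]
  rcases eq_of_isNN L ha with h | h | h | h <;> rw [h]
  · rw [rowSum_neg L Δ lam2 heven]
  · exact hy
  · rw [rowSum_neg L Δ lam2 heven, hy]

/-- the nearest-neighbour count is at most four (no distinctness of `±x̂, ±ŷ` needed). [folklore] -/
theorem card_nn_le_four : (Finset.univ.filter fun a : Tor L => IsNN L a = true).card ≤ 4 := by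
  classical
  have hsub : (Finset.univ.filter fun a : Tor L => IsNN L a = true) ⊆ {ex L, -ex L, ey L, -ey L} := by
    intro a ha
    rw [Finset.mem_filter] at ha
    rcases eq_of_isNN L ha.2 with h | h | h | h <;> simp [h]
  refine (Finset.card_le_card hsub).trans ?_
  refine (Finset.card_insert_le _ _).trans ?_
  refine (Nat.add_le_add_right (Finset.card_insert_le _ _) 1).trans ?_
  refine (Nat.add_le_add_right (Nat.add_le_add_right (Finset.card_insert_le _ _) 1) 1).trans ?_
  rw [Finset.card_singleton]

/-- `Σ_a [a ∈ NN]·Σ_b C0(a,b)² ≤ 4·Σ_b C0(x̂,b)²`. [folklore] -/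
theorem sum_rows_le (Δ lam2 : ℝ) {f : Tor L → ℝ} (heven : ∀ r : Tor L, f (-r) = f r)
    (hsw : ∀ r : Tor L, f (r.2, r.1) = f r) :
    ∑ a : Tor L, (if IsNN L a = true then (1 : ℝ) else 0) * ∑ b : Tor L, C0fn L Δ lam2 f (a, b) ^ 2
      ≤ 4 * ∑ b : Tor L, C0fn L Δ lam2 f (ex L, b) ^ 2 := by
  classical
  set S := ∑ b : Tor L, C0fn L Δ lam2 f (ex L, b) ^ 2 with hS
  have hS0 : 0 ≤ S := Finset.sum_nonneg fun b _ => sq_nonneg _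
  have e : ∀ a : Tor L, (if IsNN L a = true then (1 : ℝ) else 0) * ∑ b : Tor L, C0fn L Δ lam2 f (a, b) ^ 2
      = if IsNN L a = true then S else 0 := by
    intro a
    split_ifs with ha
    · rw [one_mul, rowSum_nn L Δ lam2 heven hsw ha]
    · rw [zero_mul]
  rw [Finset.sum_congr rfl fun a _ => e a, ← Finset.sum_filter, Finset.sum_const, nsmul_eq_mul]
  have hc : ((Finset.univ.filter fun a : Tor L => IsNN L a = true).card : ℝ) ≤ 4 := by
    exact_mod_cast card_nn_le_four L
  nlinarith

/-- the `x̂` row without its two hard-core zeros `b = 0`, `b = x̂`. [folklore] -/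
theorem rowSum_ex_erase (Δ lam2 : ℝ) (f : Tor L → ℝ) :
    ∑ b : Tor L, C0fn L Δ lam2 f (ex L, b) ^ 2
      = ∑ b ∈ ((Finset.univ : Finset (Tor L)).erase 0).erase (ex L), C0fn L Δ lam2 f (ex L, b) ^ 2 := by
  classical
  have h0 : C0fn L Δ lam2 f (ex L, 0) ^ 2 = 0 := by
    rw [C0fn_D L Δ lam2 f (ex L, 0) (by unfold InD; simp), zero_pow two_ne_zero]
  have h1 : C0fn L Δ lam2 f (ex L, ex L) ^ 2 = 0 := by
    rw [C0fn_D L Δ lam2 f (ex L, ex L) (by unfold InD; simp), zero_pow two_ne_zero]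
  rw [Finset.sum_erase ((Finset.univ : Finset (Tor L)).erase 0) (f := fun b => C0fn L Δ lam2 f (ex L, b) ^ 2) h1,
    Finset.sum_erase (Finset.univ : Finset (Tor L)) (f := fun b => C0fn L Δ lam2 f (ex L, b) ^ 2) h0]

/-! ## §4 The reduction -/

/-- ★ `Sh ≤ 12·Σ_{b ∉ {0,x̂}} C0(x̂,b)²` for an even, swap-symmetric profile. [folklore] -/
theorem shell_reduction (Δ lam2 : ℝ) {f : Tor L → ℝ} (heven : ∀ r : Tor L, f (-r) = f r)
    (hsw : ∀ r : Tor L, f (r.2, r.1) = f r) :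
    nC0shell L Δ lam2 f
      ≤ 12 * ∑ b ∈ ((Finset.univ : Finset (Tor L)).erase 0).erase (ex L), C0fn L Δ lam2 f (ex L, b) ^ 2 := by
  have h1 := nC0shell_le_Wsum L Δ lam2 f
  rw [Wsum_eq, sum_snd_eq_fst L Δ lam2 heven, sum_diff_eq_fst L Δ lam2 heven, sum_fst_rows] at h1
  have h2 := sum_rows_le L Δ lam2 heven hsw
  rw [rowSum_ex_erase] at h2
  linarith

end ShellRow

/-- ★ **`ShellReduction L Δ` holds** (for every `L`; the x-mirror hypothesis is not needed). [folklore] -/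
theorem shellReduction_holds (Δ : ℝ) : ShellReduction L Δ :=
  fun lam2 _ hf hsw _ => ShellRow.shell_reduction L Δ lam2 hf.2.1 hsw

end Summit.HubbardSuperconductivity.HubbardSuperconductivity.Theorems.AnisotropyChord.Transfer.Fibre3

end
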